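import Summits.Ventures.Crystal3D.Theorems.StickyWulffConstantTextureLiminfFluxPolyline
import Summits.Ventures.Crystal3D.Theorems.StickyWulffConstantTextureLiminfFluxZigzagSel
import HarnessLib

/-!
# TexShadow vocabulary — CHOSEN-SLOT selectors and their flux (`IsZigSelectorAt v`, `bilayerRiseAt v`, `plateFluxAt v`)
# (lane T, crux `TextureLiminfV5`, stmt-Ventures-23912; cf-p1 RULING 2026-08-29T03:35:17Z (a) «`IsZigSelectorAt (L σ e v step)` AS PROPOSED — GO»)

HONEST FRAMING. Venture `Summits/Ventures/Crystal3D` (cell `crystal3d-full`), route `route-Ventures-StickyWulffConstant`, helper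
`--supports` the law-v5 crux `TextureLiminfV5` (stmt-Ventures-23912).  DEFINITIONS + one-line unfoldings only; nothing about any wall law is
proved or claimed; rung F-C1 not moved.

WHY NAMES.  The engine `plate_lines_ge_flux_up` (…FluxCountUp, p693446) and the glue `bilayerWallAt_of_K1a_at` (…LineCountGlueOneSidedUp, p693671)
need no selector predicate (they take `IsUpBond` steps with rises `≥ 1/4` and certify the flux `√2·⟪step i, L⁻¹e⟫`).  The names below are for the
USERS — lane G's K3 certificate predicate (19480-p2 g11 queue (ii), K3-ENGINE-SPEC §2 family menu `UP_v / DOWN_v`) and lane T's texture builder —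
who must quote the chosen-slot domination of a table without an existential step sequence in scope:
* `IsZigSelectorAt L σ e v step` — the three clauses returned by `barlow_hlines_oriented_oneSided_at` (19480-p2 p692347): every step an e-upward bond
  (`IsUpBond`), `step k = v` on Δ-bilayers (`σ k = 1`), the capper rise `bilayerRise` on ∇-bilayers (`σ k = −1`);
* `bilayerRiseAt L σ e v i := if σ i = 1 then ⟪L v, e⟫ else bilayerRise L σ e i` — the rise of such a selector on bilayer `i`
  (`IsZigSelectorAt.inner_eq`), hence `≥ 1/4` when `⟪L v, e⟫ ≥ √2/2` (`IsZigSelectorAt.quarter_le`);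
* `plateFluxAt τ L σ e v i := if τ ≤ ⟪L v, e⟫ then √2·bilayerRiseAt L σ e v i else 0` — the chosen slot's flux per unit basal area, guarded by
  the steepness of `v` exactly as `plateFlux τ` is guarded by `PlateLaunchable τ` (`plateFluxAt_of_steep`);
* `FluxDominatedAt₁ τ L₁ σ₁ v c` / `FluxDominatedAt₂ τ L₂ σ₂ v c` — ONE-SIDED domination of a table by half the chosen flux of the bottom plate
  (toward `e₃`) resp. of the top plate (toward `−e₃`): the `hdom` hypothesis of `bilayerWallAt_of_K1a_at` reads `FluxDominatedAt₁ (√2/2) L₁ σ₁ v c`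
  after `plateFluxAt_of_steep`.
WHAT THIS IS NOT: no proof of any wall law; F-C1 not moved.
-/

noncomputable section

open scoped InnerProductSpace

namespace Summit.Ventures.Crystal3D.Cruxes.TextureLiminf.TexShadow

open Summit.Ventures.Crystal3D Summit.Ventures.Crystal3D.Theorems
open Literature.MathematicalPhysics.StatisticalMechanics (IsHaggSeq)

/-- **A chosen-slot zig selector** for the plate `(L, σ)` steered toward `e` with Δ-slot `v`: every step is an e-upward bond of its bilayer,
the Δ-bilayers (`σ k = 1`) use the slot `v` itself, the ∇-bilayers (`σ k = −1`) a step with the capper rise `bilayerRise`.  This is verbatim the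
conjunction returned by lane G's `barlow_hlines_oriented_oneSided_at`. -/
def IsZigSelectorAt (L : E3 ≃ₗᵢ[ℝ] E3) (σ : ℤ → ℤ) (e v : E3) (step : ℤ → E3) : Prop :=
  (∀ k : ℤ, IsUpBond L σ e k (step k)) ∧ (∀ k : ℤ, σ k = 1 → step k = v) ∧
    (∀ k : ℤ, σ k = -1 → ⟪step k, L.symm e⟫_ℝ = bilayerRise L σ e k)

/-- **The chosen-slot rise** of bilayer `i`: `⟪L v, e⟫` on a Δ-bilayer, the capper rise `bilayerRise L σ e i` on a ∇-bilayer. -/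
def bilayerRiseAt (L : E3 ≃ₗᵢ[ℝ] E3) (σ : ℤ → ℤ) (e v : E3) (i : ℤ) : ℝ :=
  if σ i = 1 then ⟪L v, e⟫_ℝ else bilayerRise L σ e i

open scoped Classical in
/-- **The chosen-slot flux** of bilayer `i` per unit basal area at steepness threshold `τ`: `√2 · bilayerRiseAt` if the slot `v` rises at least
`τ` toward `e`, else `0` (the analogue of `plateFlux τ`, whose guard is `PlateLaunchable τ`). -/
def plateFluxAt (τ : ℝ) (L : E3 ≃ₗᵢ[ℝ] E3) (σ : ℤ → ℤ) (e v : E3) (i : ℤ) : ℝ :=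
  if τ ≤ ⟪L v, e⟫_ℝ then Real.sqrt 2 * bilayerRiseAt L σ e v i else 0

/-- **One-sided chosen-slot domination, bottom plate**: `c i j ≤ plateFluxAt τ L₁ σ₁ e₃ v i / 2` for all `i, j`. -/
def FluxDominatedAt₁ (τ : ℝ) (L₁ : E3 ≃ₗᵢ[ℝ] E3) (σ₁ : ℤ → ℤ) (v : E3) (c : ℤ → ℤ → ℝ) : Prop :=
  ∀ i j : ℤ, c i j ≤ plateFluxAt τ L₁ σ₁ e₃ v i / 2

/-- **One-sided chosen-slot domination, top plate** (steered toward `−e₃`): `c i j ≤ plateFluxAt τ L₂ σ₂ (−e₃) v j / 2` for all `i, j`. -/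
def FluxDominatedAt₂ (τ : ℝ) (L₂ : E3 ≃ₗᵢ[ℝ] E3) (σ₂ : ℤ → ℤ) (v : E3) (c : ℤ → ℤ → ℝ) : Prop :=
  ∀ i j : ℤ, c i j ≤ plateFluxAt τ L₂ σ₂ (-e₃) v j / 2

/-! ## One-line unfoldings -/

/-- The three clauses give a chosen-slot selector (the shape returned by `barlow_hlines_oriented_oneSided_at`). -/
theorem isZigSelectorAt_of_clauses {L : E3 ≃ₗᵢ[ℝ] E3} {σ : ℤ → ℤ} {e v : E3} {step : ℤ → E3}
    (hup : ∀ k : ℤ, IsUpBond L σ e k (step k)) (hΔ : ∀ k : ℤ, σ k = 1 → step k = v)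
    (hcap : ∀ k : ℤ, σ k = -1 → ⟪step k, L.symm e⟫_ℝ = bilayerRise L σ e k) : IsZigSelectorAt L σ e v step :=
  ⟨hup, hΔ, hcap⟩

/-- The steps of a chosen-slot selector are e-upward bonds. -/
theorem IsZigSelectorAt.upBond {L : E3 ≃ₗᵢ[ℝ] E3} {σ : ℤ → ℤ} {e v : E3} {step : ℤ → E3} (h : IsZigSelectorAt L σ e v step)
    (k : ℤ) : IsUpBond L σ e k (step k) :=
  h.1 k

/-- **The rise of a chosen-slot selector is `bilayerRiseAt`.** -/
theorem IsZigSelectorAt.inner_eq {L : E3 ≃ₗᵢ[ℝ] E3} {σ : ℤ → ℤ} (hσ : IsHaggSeq σ) {e v : E3} {step : ℤ → E3}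
    (h : IsZigSelectorAt L σ e v step) (k : ℤ) : ⟪step k, L.symm e⟫_ℝ = bilayerRiseAt L σ e v k := by
  unfold bilayerRiseAt
  rcases hσ k with h1 | h1
  · rw [if_pos h1, h.2.1 k h1, ← LinearIsometryEquiv.inner_map_map L v (L.symm e), LinearIsometryEquiv.apply_symm_apply]
  · rw [if_neg (by omega)]; exact h.2.2 k h1

/-- A chosen slot rising `≥ √2/2` gives rises `≥ 1/4` on every bilayer (`bilayerRise ≥ 1/4` on the ∇-bilayers). -/
theorem quarter_le_bilayerRiseAt (L : E3 ≃ₗᵢ[ℝ] E3) (σ : ℤ → ℤ) {e : E3} (he : ‖e‖ = 1) {v : E3}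
    (hsteep : Real.sqrt 2 / 2 ≤ ⟪L v, e⟫_ℝ) (i : ℤ) : 1 / 4 ≤ bilayerRiseAt L σ e v i := by
  have h12 : (1 : ℝ) ≤ Real.sqrt 2 := by
    rw [show (1 : ℝ) = Real.sqrt 1 by simp]; exact Real.sqrt_le_sqrt (by norm_num)
  unfold bilayerRiseAt
  split_ifs
  · linarith
  · exact quarter_le_bilayerRise L σ he i

/-- The rises of a chosen-slot selector with a steep slot are `≥ 1/4` (the `hr` hypothesis of `plate_lines_ge_flux_up`). -/
theorem IsZigSelectorAt.quarter_le {L : E3 ≃ₗᵢ[ℝ] E3} {σ : ℤ → ℤ} (hσ : IsHaggSeq σ) {e v : E3} (he : ‖e‖ = 1)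
    (hsteep : Real.sqrt 2 / 2 ≤ ⟪L v, e⟫_ℝ) {step : ℤ → E3} (h : IsZigSelectorAt L σ e v step) (k : ℤ) :
    1 / 4 ≤ ⟪step k, L.symm e⟫_ℝ := by
  rw [h.inner_eq hσ k]; exact quarter_le_bilayerRiseAt L σ he hsteep k

/-- Under the steepness guard the chosen flux is `√2 · bilayerRiseAt`. -/
theorem plateFluxAt_of_steep {τ : ℝ} {L : E3 ≃ₗᵢ[ℝ] E3} {σ : ℤ → ℤ} {e v : E3} (hsteep : τ ≤ ⟪L v, e⟫_ℝ) (i : ℤ) :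
    plateFluxAt τ L σ e v i = Real.sqrt 2 * bilayerRiseAt L σ e v i := by
  rw [plateFluxAt, if_pos hsteep]

/-- Without the steepness guard the chosen flux vanishes (so a dominated table vanishes too). -/
theorem plateFluxAt_of_not_steep {τ : ℝ} {L : E3 ≃ₗᵢ[ℝ] E3} {σ : ℤ → ℤ} {e v : E3} (h : ¬ τ ≤ ⟪L v, e⟫_ℝ) (i : ℤ) :
    plateFluxAt τ L σ e v i = 0 := by
  rw [plateFluxAt, if_neg h]

/-- **The `hdom` hypothesis of `bilayerWallAt_of_K1a_at` from `FluxDominatedAt₁ (√2/2)`** (steep chosen slot): for a selector `step` at `v`,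
`c i j ≤ √2·⟪step i, L₁⁻¹e₃⟫ / 2`. -/
theorem FluxDominatedAt₁.le_inner {L₁ : E3 ≃ₗᵢ[ℝ] E3} {σ₁ : ℤ → ℤ} (hσ₁ : IsHaggSeq σ₁) {v : E3} {c : ℤ → ℤ → ℝ} {τ : ℝ}
    (hdom : FluxDominatedAt₁ τ L₁ σ₁ v c) (hsteep : τ ≤ ⟪L₁ v, e₃⟫_ℝ) {step : ℤ → E3} (h : IsZigSelectorAt L₁ σ₁ e₃ v step)
    (i j : ℤ) : c i j ≤ Real.sqrt 2 * ⟪step i, L₁.symm e₃⟫_ℝ / 2 := by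
  rw [h.inner_eq hσ₁ i, ← plateFluxAt_of_steep hsteep]; exact hdom i j

/-- The same for the top plate (`FluxDominatedAt₂`, steering `−e₃`). -/
theorem FluxDominatedAt₂.le_inner {L₂ : E3 ≃ₗᵢ[ℝ] E3} {σ₂ : ℤ → ℤ} (hσ₂ : IsHaggSeq σ₂) {v : E3} {c : ℤ → ℤ → ℝ} {τ : ℝ}
    (hdom : FluxDominatedAt₂ τ L₂ σ₂ v c) (hsteep : τ ≤ ⟪L₂ v, -e₃⟫_ℝ) {step : ℤ → E3} (h : IsZigSelectorAt L₂ σ₂ (-e₃) v step)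
    (i j : ℤ) : c i j ≤ Real.sqrt 2 * ⟪step j, L₂.symm (-e₃)⟫_ℝ / 2 := by
  rw [h.inner_eq hσ₂ j, ← plateFluxAt_of_steep hsteep]; exact hdom i j

/-- The user-facing `if`-form of `bilayerWallAt_of_K1a_at`'s domination from `FluxDominatedAt₁` (steep slot). -/
theorem FluxDominatedAt₁.le_ite {L₁ : E3 ≃ₗᵢ[ℝ] E3} {σ₁ : ℤ → ℤ} {v : E3} {c : ℤ → ℤ → ℝ} {τ : ℝ}
    (hdom : FluxDominatedAt₁ τ L₁ σ₁ v c) (hsteep : τ ≤ ⟪L₁ v, e₃⟫_ℝ) (i j : ℤ) :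
    c i j ≤ Real.sqrt 2 * (if σ₁ i = 1 then ⟪L₁ v, e₃⟫_ℝ else bilayerRise L₁ σ₁ e₃ i) / 2 := by
  have h := hdom i j
  rw [plateFluxAt_of_steep hsteep] at h
  exact h

end Summit.Ventures.Crystal3D.Cruxes.TextureLiminf.TexShadow

end
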